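import Summits.BirchSwinnertonDyer.BirchSwinnertonDyer.Theorems.PrintCFramBottomClassIndexLawFiveLeBorelTopLayerHind
import HarnessLib

/-!
# Route `PrintCFram`, crux C2 `BottomClassIndexLawFiveLe` (stmt-BirchSwinnertonDyer-20372), line
# `eisenstein-resource-bdp-line`, stub `stub_kolyvaginUpper_borelCM_pairSum_offKrizLi`:
# **THE SPLIT (B4): DECORRELATING A CLASS FROM `x` BY INTEGER SUBTRACTION** — for two classes `x`, `s`
# with `s` no deeper than `x` (+1), some `s − k·x` (`k ∈ ℤ`) is either `0` on `Γ_{K(W[n])}` or has a top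
# layer INDEPENDENT of the top layer of `x`
# (cell `bsd-print-cfram`, seat `bsd-line-cfram-p1-w2` g7; helper `--supports` 20372; 0 facts, 0 defs, 0 sorry)

HONEST FRAMING. Nothing about BSD is proved here, and nothing of the stub itself. This is the displayed
hypothesis `hsplit` (B4) of the abstract Borel descent (`…BorelDescentClaimB`) on `H¹(K, W[p^M])`, in the
top-functional currency of FILE 6/7: `val z ρ := [z, ρ]^♭ ∈ W(ℚ̄)` (`ρ ∈ Γ_{K(W[n])}`), depth `e` = least with
`μ^e ∘ val z = 0`, top `T_z = μ^{e−1} ∘ val z` (values on the line `ker μ`).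

* `top_sub_zsmul_eq_zero` — the subtraction step: if `T_s = w·T_x` pointwise (`w ∈ ℤ`) and `e_x = e_s + 2k`,
  then `μ^{e_s−1}` kills the values of `s − (w m^k)·x` (`m^k` acts as `μ^{2k}`): the depth drops.
* `parity_eq_of_top_rel` — a relation `a T_x + b T_s = 0` with `p ∤ b` forces `(−1)^{e_x−1} = (−1)^{e_s−1}`
  (the parity twist `sum_top_twist_parity` of `…BorelTopLayerClasses`: an `𝓞`-antilinear `g ∈ Γ_K` turns the
  relation into `a(−1)^{e_x−1}T_x + b(−1)^{e_s−1}T_s = 0`).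
* **`exists_sub_zsmul_top_indep`** — for `x` with a non-zero top at depth `e_x ≥ 1` and ANY class `s` whose
  values are killed by `μ^n`, `n ≤ e_x + 1`: there are `k ∈ ℤ` and `e′ ≤ n` such that the values of
  `s′ = s − k·x` are killed by `μ^{e′}` and EITHER `e′ = 0` (so `s′` vanishes on `Γ_{K(W[n])}`; on the class
  `s′ = 0` by `eq_zero_of_forall_h1Eval_eq_zero_of_cmRamified`) OR `e′ ≥ 1`, `s′` has a non-zero top at depth
  `e′`, and the tops of `x` and `s′` are INDEPENDENT (`a T_x + b T_{s′} = 0 ⟹ p ∣ a ∧ p ∣ b`). Induction on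
  `n`; no eigen-hypothesis is needed (if `x`, `s` are `c_*`-eigenclasses of the same sign, so is `s′`).

With `…BorelRequestsCebotarev` (FILE 7′) and `hind_of_hind_on_classes` this is what shape (B3) of the abstract
descent consumes (the triple `{x ↦ 0, s′, c(ℓ)}`; assembly left to the successor). THEOREMS ONLY; no
definition, no named fact, no `sorry`. BSD is not proved by any of this; no summit statement is proved by this
seat. Reference: [McCallumLMS1991] §3 (independent classes, Cor. 3.2).
-/

set_option autoImplicit false
-- `…BirchSwinnertonDyer.BirchSwinnertonDyer.Theorems…` is the problem's mandated namespace (D-0017).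
set_option linter.dupNamespace false

noncomputable section

open scoped Classical

namespace Summit.BirchSwinnertonDyer.BirchSwinnertonDyer.Theorems.PrintCFram.BorelKolyvaginPairing

open WeierstrassCurve NumberField IsDedekindDomain Field Literature.NumberTheory.EllipticCurves
  Literature.NumberTheory.GaloisRepresentations Literature.NumberTheory.EllipticCurves.Rank1Residual
  Summit.BirchSwinnertonDyer.BirchSwinnertonDyer.Theorems.PrintCFram.BorelHomothety

variable (W : WeierstrassCurve ℚ) [W.IsElliptic] (p : ℕ) [hp : Fact p.Prime]
variable {K : Type} [Field K] [NumberField K]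

omit [W.IsElliptic] hp in
/-- Linearity of the transported values: `[s − c·x, ρ]^♭ = [s, ρ]^♭ − c·[x, ρ]^♭`. [folklore] -/
theorem val_sub_zsmul (n : ℤ) (s x : galH1Torsion (W.baseChange K) n) (c : ℤ)
    {ρ : absoluteGaloisGroup K} (hρ : ρ ∈ torsionFixing (W.baseChange K) n) :
    ((RatClosure.torsionEquiv (K := K) W n).symm (h1Eval (W.baseChange K) n (s - c • x) ρ) :
        W.geomPoints) =
      ((RatClosure.torsionEquiv (K := K) W n).symm (h1Eval (W.baseChange K) n s ρ) : W.geomPoints) -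
        c • ((RatClosure.torsionEquiv (K := K) W n).symm (h1Eval (W.baseChange K) n x ρ) :
          W.geomPoints) := by
  rw [← h1EvalHom_apply _ _ hρ, ← h1EvalHom_apply _ _ hρ, ← h1EvalHom_apply _ _ hρ, map_sub, map_zsmul,
    map_sub, map_zsmul, AddSubgroupClass.coe_sub, AddSubgroupClass.coe_zsmul]

omit [W.IsElliptic] hp in
/-- **The subtraction step.** If the top of `s` (depth `e_s`) is `w` times the top of `x` (depth
`e_x = e_s + 2k`) pointwise, then `μ^{e_s−1}` kills the values of `s − (w m^k)·x`. [folklore] -/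
theorem top_sub_zsmul_eq_zero {μ : AddMonoid.End W.geomPoints} {m : ℤ} (hμμ : ∀ P, μ (μ P) = m • P)
    (n : ℤ) (x s : galH1Torsion (W.baseChange K) n) {ex es k : ℕ} (hes : 1 ≤ es) (hk : ex = es + 2 * k)
    {w : ℤ}
    (hw : ∀ ρ ∈ torsionFixing (W.baseChange K) n,
      (μ ^ (es - 1)) ((RatClosure.torsionEquiv (K := K) W n).symm (h1Eval (W.baseChange K) n s ρ) :
        W.geomPoints) =
        w • (μ ^ (ex - 1)) ((RatClosure.torsionEquiv (K := K) W n).symm (h1Eval (W.baseChange K) n x ρ) :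
          W.geomPoints))
    {ρ : absoluteGaloisGroup K} (hρ : ρ ∈ torsionFixing (W.baseChange K) n) :
    (μ ^ (es - 1)) ((RatClosure.torsionEquiv (K := K) W n).symm
      (h1Eval (W.baseChange K) n (s - (w * m ^ k) • x) ρ) : W.geomPoints) = 0 := by
  rw [val_sub_zsmul W n s x _ hρ, map_sub, hw ρ hρ, map_zsmul, mul_smul, ← map_zsmul (μ ^ (es - 1)),
    ← pow_two_mul_apply W hμμ k, sub_eq_zero]
  congr 1
  change _ = (μ ^ (es - 1) * μ ^ (2 * k)) _
  rw [← pow_add, show es - 1 + 2 * k = ex - 1 by omega]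

omit [W.IsElliptic] in
/-- **A top relation with `p ∤ b` forces equal depth parity.** If `a T_x + b T_s = 0` pointwise with
`p ∤ b` and `s` has a non-zero top, then `(−1)^{e_x−1} = (−1)^{e_s−1}` (parity twist by an `𝓞`-antilinear
`g ∈ Γ_K`, then `2b T_s = 0` at a witness of the top if the parities differed). [cite: McCallumLMS1991, §3] -/
theorem parity_eq_of_top_rel {s : AlgebraicClosure ℚ} {μ : AddMonoid.End W.geomPoints} {m : ℤ}
    (hs : s ^ 2 = ((-(p : ℤ) : ℤ) : AlgebraicClosure ℚ)) (hm : m.natAbs = p)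
    (hμμ : ∀ P, μ (μ P) = m • P)
    (hanti : ∀ g : absoluteGaloisGroup ℚ, g • s = -s → ∀ P, μ (g • P) = -(g • μ P))
    (hp2 : p ≠ 2) (hKp : ∀ y : K, y ^ 2 ≠ -(p : K))
    (n : ℤ) (x z : galH1Torsion (W.baseChange K) n) {ex ez : ℕ}
    (hze : ∀ ρ ∈ torsionFixing (W.baseChange K) n,
      (μ ^ ez) ((RatClosure.torsionEquiv (K := K) W n).symm (h1Eval (W.baseChange K) n z ρ) :
        W.geomPoints) = 0)
    (hztop : ∃ ρ ∈ torsionFixing (W.baseChange K) n,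
      (μ ^ (ez - 1)) ((RatClosure.torsionEquiv (K := K) W n).symm (h1Eval (W.baseChange K) n z ρ) :
        W.geomPoints) ≠ 0)
    {a b : ℤ} (hb : ¬ (p : ℤ) ∣ b)
    (hrel : ∀ ρ ∈ torsionFixing (W.baseChange K) n,
      a • (μ ^ (ex - 1)) ((RatClosure.torsionEquiv (K := K) W n).symm (h1Eval (W.baseChange K) n x ρ) :
        W.geomPoints) +
      b • (μ ^ (ez - 1)) ((RatClosure.torsionEquiv (K := K) W n).symm (h1Eval (W.baseChange K) n z ρ) :
        W.geomPoints) = 0) :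
    (-1 : ℤ) ^ (ex - 1) = (-1) ^ (ez - 1) := by
  by_contra hne
  obtain ⟨g, hg⟩ := exists_restrict_smul_eq_neg p K hKp hs
  obtain ⟨ρ₀, hρ₀, hρ₀top⟩ := hztop
  -- the relation and its parity twist, on the family `![x, z]`
  have hrel' : ∀ ρ ∈ torsionFixing (W.baseChange K) n,
      ∑ i, (![a, b] : Fin 2 → ℤ) i • (μ ^ ((![ex, ez] : Fin 2 → ℕ) i - 1))
        ((RatClosure.torsionEquiv (K := K) W n).symm (h1Eval (W.baseChange K) n (![x, z] i) ρ) :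
          W.geomPoints) = 0 := fun ρ hρ ↦ by
    rw [Fin.sum_univ_two]
    exact hrel ρ hρ
  have htw := sum_top_twist_parity W hanti n ![x, z] ![ex, ez] hg ![a, b] hrel' hρ₀
  rw [Fin.sum_univ_two] at htw
  have h0 := hrel ρ₀ hρ₀
  simp only [Matrix.cons_val_zero, Matrix.cons_val_one] at htw
  -- the two signs differ; in either case `2 b T_z(ρ₀) = 0`
  have h2 : (2 : ℤ) • (b • (μ ^ (ez - 1)) ((RatClosure.torsionEquiv (K := K) W n).symm
      (h1Eval (W.baseChange K) n z ρ₀) : W.geomPoints)) = 0 := by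
    rcases neg_one_pow_eq_or ℤ (ex - 1) with h1 | h1 <;>
      rcases neg_one_pow_eq_or ℤ (ez - 1) with h3 | h3
    · exact absurd (h1.trans h3.symm) hne
    · rw [h1, h3] at htw
      rw [two_zsmul]
      linear_combination (norm := module) h0 - htw
    · rw [h1, h3] at htw
      rw [two_zsmul]
      linear_combination (norm := module) h0 + htw
    · exact absurd (h1.trans h3.symm) hne
  have hpt := prime_zsmul_eq_zero_of_apply_eq_zero W p hm hμμ (apply_top_eq_zero W (hze ρ₀ hρ₀))
  have hbz : b • (μ ^ (ez - 1)) ((RatClosure.torsionEquiv (K := K) W n).symm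
      (h1Eval (W.baseChange K) n z ρ₀) : W.geomPoints) = 0 :=
    eq_zero_of_two_zsmul_of_prime_zsmul p (hp.out.odd_of_ne_two hp2) (by rw [smul_comm, hpt, smul_zero]) h2
  exact hb (prime_dvd_of_zsmul_eq_zero p hp.out hρ₀top hpt hbz)

omit [W.IsElliptic] in
/-- **The split (B4).** `x` with a non-zero top at depth `e_x ≥ 1`; `s` any class whose values are killed by
`μ^n`, `n ≤ e_x + 1`. Then for some `k ∈ ℤ` and `e′ ≤ n` the values of `s′ = s − k·x` are killed by `μ^{e′}`,
and either `e′ = 0`, or `e′ ≥ 1`, `s′` has a non-zero top at depth `e′` and **the tops of `x` and `s′` are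
independent**: `a T_x + b T_{s′} = 0 ⟹ p ∣ a ∧ p ∣ b`. (Induction on `n`: if the tops are dependent the
relation has `p ∤ b`, the parities agree (`parity_eq_of_top_rel`), so `e_x − n` is even and `≥ 0`, and one
subtraction step lowers the depth of `s`.) [cite: McCallumLMS1991, §3] -/
theorem exists_sub_zsmul_top_indep {s : AlgebraicClosure ℚ} {μ : AddMonoid.End W.geomPoints} {m : ℤ}
    (hs : s ^ 2 = ((-(p : ℤ) : ℤ) : AlgebraicClosure ℚ)) (hm : m.natAbs = p)
    (hμμ : ∀ P, μ (μ P) = m • P)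
    (hanti : ∀ g : absoluteGaloisGroup ℚ, g • s = -s → ∀ P, μ (g • P) = -(g • μ P))
    (hp2 : p ≠ 2) (hKp : ∀ y : K, y ^ 2 ≠ -(p : K))
    (nl : ℤ) (x : galH1Torsion (W.baseChange K) nl) {ex : ℕ} (hex : 1 ≤ ex)
    (hxe : ∀ ρ ∈ torsionFixing (W.baseChange K) nl,
      (μ ^ ex) ((RatClosure.torsionEquiv (K := K) W nl).symm (h1Eval (W.baseChange K) nl x ρ) :
        W.geomPoints) = 0)
    (hxtop : ∃ ρ ∈ torsionFixing (W.baseChange K) nl,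
      (μ ^ (ex - 1)) ((RatClosure.torsionEquiv (K := K) W nl).symm (h1Eval (W.baseChange K) nl x ρ) :
        W.geomPoints) ≠ 0)
    (n : ℕ) (hn : n ≤ ex + 1) (z : galH1Torsion (W.baseChange K) nl)
    (hz : ∀ ρ ∈ torsionFixing (W.baseChange K) nl,
      (μ ^ n) ((RatClosure.torsionEquiv (K := K) W nl).symm (h1Eval (W.baseChange K) nl z ρ) :
        W.geomPoints) = 0) :
    ∃ (k : ℤ) (e' : ℕ), e' ≤ n ∧
      (∀ ρ ∈ torsionFixing (W.baseChange K) nl,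
        (μ ^ e') ((RatClosure.torsionEquiv (K := K) W nl).symm
          (h1Eval (W.baseChange K) nl (z - k • x) ρ) : W.geomPoints) = 0) ∧
      (e' = 0 ∨ (1 ≤ e' ∧
        (∃ ρ ∈ torsionFixing (W.baseChange K) nl,
          (μ ^ (e' - 1)) ((RatClosure.torsionEquiv (K := K) W nl).symm
            (h1Eval (W.baseChange K) nl (z - k • x) ρ) : W.geomPoints) ≠ 0) ∧
        ∀ a b : ℤ, (∀ ρ ∈ torsionFixing (W.baseChange K) nl,
          a • (μ ^ (ex - 1)) ((RatClosure.torsionEquiv (K := K) W nl).symm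
            (h1Eval (W.baseChange K) nl x ρ) : W.geomPoints) +
          b • (μ ^ (e' - 1)) ((RatClosure.torsionEquiv (K := K) W nl).symm
            (h1Eval (W.baseChange K) nl (z - k • x) ρ) : W.geomPoints) = 0) →
          (p : ℤ) ∣ a ∧ (p : ℤ) ∣ b)) := by
  obtain ⟨ρ₁, hρ₁, hρ₁top⟩ := hxtop
  have hpx := prime_zsmul_eq_zero_of_apply_eq_zero W p hm hμμ (apply_top_eq_zero W (hxe ρ₁ hρ₁))
  -- induction on the depth bound `n`, for all classes `z`
  induction n generalizing z with
  | zero =>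
    exact ⟨0, 0, le_rfl, fun ρ hρ ↦ by rw [zero_smul, sub_zero]; exact hz ρ hρ, Or.inl rfl⟩
  | succ n ih =>
    -- either `μ^n` already kills the values, or `z` has exact depth `n + 1`
    by_cases hlow : ∀ ρ ∈ torsionFixing (W.baseChange K) nl,
        (μ ^ n) ((RatClosure.torsionEquiv (K := K) W nl).symm (h1Eval (W.baseChange K) nl z ρ) :
          W.geomPoints) = 0
    · obtain ⟨k, e', he', hk, hrest⟩ := ih (by omega) z hlow
      exact ⟨k, e', by omega, hk, hrest⟩
    push Not at hlow
    obtain ⟨ρ₀, hρ₀, hρ₀top⟩ := hlow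
    -- are the tops of `x` and `z` independent?
    by_cases hind : ∀ a b : ℤ, (∀ ρ ∈ torsionFixing (W.baseChange K) nl,
        a • (μ ^ (ex - 1)) ((RatClosure.torsionEquiv (K := K) W nl).symm
          (h1Eval (W.baseChange K) nl x ρ) : W.geomPoints) +
        b • (μ ^ (n + 1 - 1)) ((RatClosure.torsionEquiv (K := K) W nl).symm
          (h1Eval (W.baseChange K) nl z ρ) : W.geomPoints) = 0) → (p : ℤ) ∣ a ∧ (p : ℤ) ∣ b
    · refine ⟨0, n + 1, le_rfl, fun ρ hρ ↦ by rw [zero_smul, sub_zero]; exact hz ρ hρ,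
        Or.inr ⟨by omega, ⟨ρ₀, hρ₀, by rw [zero_smul, sub_zero, Nat.add_sub_cancel]; exact hρ₀top⟩,
          fun a b hab ↦ hind a b (fun ρ hρ ↦ by rw [zero_smul, sub_zero] at hab; exact hab ρ hρ)⟩⟩
    -- dependent tops: a relation with `p ∤ b`
    push Not at hind
    obtain ⟨a, b, hrel, hnot⟩ := hind
    rw [Nat.add_sub_cancel] at hrel
    have hpzρ : ∀ ρ ∈ torsionFixing (W.baseChange K) nl, (p : ℤ) • (μ ^ n)
        ((RatClosure.torsionEquiv (K := K) W nl).symm (h1Eval (W.baseChange K) nl z ρ) : W.geomPoints) = 0 := by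
      intro ρ hρ
      have h := prime_zsmul_eq_zero_of_apply_eq_zero W p hm hμμ (apply_top_eq_zero W (e := n + 1) (hz ρ hρ))
      rwa [Nat.add_sub_cancel] at h
    have hb : ¬ (p : ℤ) ∣ b := by
      intro hbd
      -- `p ∣ b` kills the `z`-term, so `a T_x = 0` at `ρ₁`, and `p ∣ a`
      have ha : (p : ℤ) ∣ a := by
        refine prime_dvd_of_zsmul_eq_zero p hp.out hρ₁top hpx ?_
        have h := hrel ρ₁ hρ₁
        obtain ⟨b', hb'⟩ := hbd
        rwa [hb', mul_comm, mul_smul, hpzρ ρ₁ hρ₁, smul_zero, add_zero] at h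
      exact hnot ha hbd
    -- equal parities, hence `ex = (n+1) + 2k`
    have hpar := parity_eq_of_top_rel W p hs hm hμμ hanti hp2 hKp nl x z (ex := ex) (ez := n + 1) hz
      ⟨ρ₀, hρ₀, by rw [Nat.add_sub_cancel]; exact hρ₀top⟩ hb
      (fun ρ hρ ↦ by rw [Nat.add_sub_cancel]; exact hrel ρ hρ)
    rw [Nat.add_sub_cancel] at hpar
    have hle : ∃ k : ℕ, ex = n + 1 + 2 * k := by
      rcases Nat.even_or_odd (ex - 1) with h1 | h1 <;> rcases Nat.even_or_odd n with h2 | h2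
      · obtain ⟨i, hi⟩ := h1
        obtain ⟨j, hj⟩ := h2
        exact ⟨i - j, by omega⟩
      · exfalso; rw [h1.neg_one_pow, h2.neg_one_pow] at hpar; norm_num at hpar
      · exfalso; rw [h1.neg_one_pow, h2.neg_one_pow] at hpar; norm_num at hpar
      · obtain ⟨i, hi⟩ := h1
        obtain ⟨j, hj⟩ := h2
        exact ⟨i - j, by omega⟩
    obtain ⟨k, hk⟩ := hle
    -- normalise the relation: `T_z = w • T_x` with `w = −u a`, `u b ≡ 1 (mod p)`
    have hcop : IsCoprime b (p : ℤ) :=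
      ((Irreducible.coprime_iff_not_dvd (Nat.prime_iff_prime_int.mp hp.out).irreducible).mpr hb).symm
    obtain ⟨u, v, huv⟩ := hcop
    have hw : ∀ ρ ∈ torsionFixing (W.baseChange K) nl,
        (μ ^ (n + 1 - 1)) ((RatClosure.torsionEquiv (K := K) W nl).symm (h1Eval (W.baseChange K) nl z ρ) :
          W.geomPoints) =
        (-(u * a)) • (μ ^ (ex - 1)) ((RatClosure.torsionEquiv (K := K) W nl).symm
          (h1Eval (W.baseChange K) nl x ρ) : W.geomPoints) := by
      intro ρ hρ
      rw [Nat.add_sub_cancel]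
      have h := congrArg (fun t ↦ u • t) (hrel ρ hρ)
      simp only [smul_add, smul_smul, smul_zero] at h
      -- `(u b) T_z = (1 − v p) T_z = T_z`
      have hub : (u * b) • (μ ^ n) ((RatClosure.torsionEquiv (K := K) W nl).symm
          (h1Eval (W.baseChange K) nl z ρ) : W.geomPoints) =
          (μ ^ n) ((RatClosure.torsionEquiv (K := K) W nl).symm (h1Eval (W.baseChange K) nl z ρ) :
            W.geomPoints) := by
        rw [show u * b = 1 - v * (p : ℤ) by linear_combination huv, sub_smul, one_smul, mul_smul, hpzρ ρ hρ,
          smul_zero, sub_zero]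
      rw [hub] at h
      rw [neg_smul, eq_neg_iff_add_eq_zero, add_comm]
      exact h
    -- one subtraction step lowers the depth of `z`
    set z₁ := z - (-(u * a) * m ^ k) • x with hz₁
    have hz₁low : ∀ ρ ∈ torsionFixing (W.baseChange K) nl,
        (μ ^ n) ((RatClosure.torsionEquiv (K := K) W nl).symm (h1Eval (W.baseChange K) nl z₁ ρ) :
          W.geomPoints) = 0 := by
      intro ρ hρ
      have := top_sub_zsmul_eq_zero W hμμ nl x z (ex := ex) (es := n + 1) (k := k) (by omega) (by omega)
        hw hρ
      rwa [Nat.add_sub_cancel] at this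
    obtain ⟨k₁, e', he', hk₁, hrest⟩ := ih (by omega) z₁ hz₁low
    have heq : z - (-(u * a) * m ^ k + k₁) • x = z₁ - k₁ • x := by rw [add_zsmul, ← sub_sub]
    refine ⟨-(u * a) * m ^ k + k₁, e', by omega, ?_, ?_⟩
    · simpa only [heq] using hk₁
    · simpa only [heq] using hrest

end Summit.BirchSwinnertonDyer.BirchSwinnertonDyer.Theorems.PrintCFram.BorelKolyvaginPairing

end
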